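import Summits.CriticalPhenomena.CardyFormulaZ2.Theorems.CardyQContinuationIsingJetsConformalStubAssemblyUpper
import Summits.CriticalPhenomena.CardyFormulaZ2.Theorems.CardyQContinuationIsingJetsConformalStubLowerComparison

/-!
# Crux `IsingJetsConformal`, stub `stub_loopSymmetricLimit_assemblyLower`:
# the lower half of the `n = 0` bridge
# (route `CardyQContinuation`, item stmt-CriticalPhenomena-5560)

Fix a conformal rectangle `R` with uniformizing datum `(φ, x)`, `η = crossRatio x`, and `κ > 0`.
Write `LS_δ = N_δ(√2) / (N_δ(√2) + √2 (Z^joint_δ(√2) - N_δ(√2)))` for the loop-symmetric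
critical FK-Ising crossing ratio of the tree's discretisation `Ω_δ` of `R`
(`fkTwoArcCrossingPolynomial`, `fkTwoArcPartitionPolynomials`) and `p = fkIsingCrossingFunction`.
Assuming the Chelkak–Smirnov crossing theorem (`ChelkakSmirnov2012_fkIsingQuadrilateralCrossing`,
a hypothesis) and the DESIGN⁻ hypothesis (for every `τ > 0` an approximant `Rm` of `R` with
`τ`-close conformal modulus and, eventually as `δ → 0⁺`, a glued Chelkak–Smirnov discrete
quadrilateral `E` whose polygonal domain `Q` is `C δ`-close to `Rm` in Radó's sense together with
the collars `C₀, C₂` of `stub_loopSymmetricLimit_lowerComparison`), we prove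
`∀ᶠ δ in 𝓝[>] 0, p η - κ < LS_δ`.

This file is the mirror image of the landed upper half
(`CardyQContinuationIsingJetsConformalStubAssemblyUpper.lean`, whose elementary helpers
`AssemblyUpper.*` are reused).

Proof. `p` is continuous (`FkIsingCrossingFunctionProps.fkIsingCrossingFunction_continuous`):
choose `τ` with `|η' - η| < τ → |p η' - p η| < κ`, and the DESIGN⁻ data `Rm, C`. For a
uniformizing datum `(φm, xm)` of `Rm` (`MarkedDomain.exists_isUniformizing_holds`)
`p η - κ < p (crossRatio xm)`. If the claim failed, `𝓝[>] 0` being countably generated there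
would be a sequence `δ_k → 0⁺` in the good set with `LS_{δ_k} ≤ p η - κ`
(`Filter.exists_seq_forall_of_frequently`). Along it: the normal forms
(`stub_loopSymmetricLimit_normalForms`) and the lower comparison
(`stub_loopSymmetricLimit_lowerComparison`, at `p = √2/(1+√2)`, `q = 2`) give
`csCrossingProb (E_k) ≤ LS_{δ_k}`; the `C δ_k`-closeness gives Radó convergence `Q_k → Rm`, the
input `stub_loopSymmetricLimit_harmonicMeasureAlongSequence` gives uniform radii and a uniform
harmonic-measure lower bound, and `stub_loopSymmetricLimit_csLimitAlongSequence` gives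
`csCrossingProb (E_k) → p (crossRatio xm) > p η - κ` — a contradiction.

References: D. Chelkak, S. Smirnov, Invent. Math. 189 (2012), Thm. 6.1; G. Grimmett,
*The Random-Cluster Model* (2006), §4.2. No new definitions, no named fact beyond the hypotheses.
-/

namespace Summit.CriticalPhenomena.CardyFormulaZ2.Theorems.CardyQContinuation

open Set Metric Filter MeasureTheory Polynomial
open scoped Topology
open Literature.Analysis.Potential (harmonicMeasure)
open Literature.Probability.RandomPlanarGeometry
open Literature.Probability.LatticeModels
open Literature.Probability.Percolation

noncomputable section

namespace AssemblyLower

open AssemblyUpper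

/-- **One mesh of the lower comparison in loop-symmetric form.** For `δ > 0` and a glued
Chelkak–Smirnov quadrilateral `(E, d₀, n)` with collars `C₀, C₂` as in
`stub_loopSymmetricLimit_lowerComparison` (black vertices off `meshDomain`, non-`Ω_δ` edges of
`E` in the collars, collar edges attached to `Ω_δ` only along the corresponding wired arc, no
vertex in both collars, black vertices see only their own collar), the Chelkak–Smirnov crossing
probability `csCrossingProb E d₀ n` is at most the loop-symmetric ratio of `Ω_δ`: both are `f` of
self-dual random-cluster crossing probabilities (`stub_loopSymmetricLimit_normalForms`), `f` is
increasing on `[0, 1]`, and the probabilities compare by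
`stub_loopSymmetricLimit_lowerComparison`. [cite: Grimmett2006, §4.2 Lemma (4.13)] -/
theorem csCrossingProb_le_loopSymmetric (R : ConformalRectangle) {δ : ℝ} (hδ : 0 < δ)
    (E : Finset (Sym2 (Site 2))) (d₀ : Site 2 × Fin 4) (n : Fin 4 → ℕ)
    (C₀ C₂ : Set (Sym2 (Site 2)))
    (h1 : Disjoint (DiscreteRect.blackVerts E d₀ n 0) (DiscreteRect.blackVerts E d₀ n 2))
    (h2 : ∀ v ∈ DiscreteRect.blackVerts E d₀ n 0 ∪ DiscreteRect.blackVerts E d₀ n 2,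
      v ∉ meshDomain R.carrier δ)
    (h3 : ∀ e ∈ E, e ∉ (discreteDomainGraph R.carrier δ).edgeSet → e ∈ C₀ ∪ C₂)
    (h4 : ∀ x : Site 2, (∃ e ∈ C₀, x ∈ e) → (∃ y, (discreteDomainGraph R.carrier δ).Adj x y) →
      x ∈ discreteArc R.carrier δ (R.arc 0))
    (h5 : ∀ x : Site 2, (∃ e ∈ C₂, x ∈ e) → (∃ y, (discreteDomainGraph R.carrier δ).Adj x y) →
      x ∈ discreteArc R.carrier δ (R.arc 2))
    (h6 : ∀ x : Site 2, (∃ e ∈ C₀, x ∈ e) → ¬ ∃ e ∈ C₂, x ∈ e)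
    (h7 : ∀ x ∈ DiscreteRect.blackVerts E d₀ n 0, ∀ e ∈ E, x ∈ e → e ∈ C₀)
    (h8 : ∀ y ∈ DiscreteRect.blackVerts E d₀ n 2, ∀ e ∈ E, y ∈ e → e ∈ C₂) :
    DiscreteRect.csCrossingProb E d₀ n ≤
      aeval (Real.sqrt 2) (fkTwoArcCrossingPolynomial R δ ArcWiring.joint) /
        (aeval (Real.sqrt 2) (fkTwoArcCrossingPolynomial R δ ArcWiring.joint) +
          Real.sqrt 2 * (aeval (Real.sqrt 2) (fkTwoArcPartitionPolynomials R δ ArcWiring.joint) -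
            aeval (Real.sqrt 2) (fkTwoArcCrossingPolynomial R δ ArcWiring.joint))) := by
  classical
  haveI := (meshDomain_finite R.isBounded hδ).fintype
  have hp := selfDualParam_mem_Icc
  have hq0 : (0 : ℝ) < Real.sqrt 2 ^ 2 := one_pos.trans_le one_le_sqrt_two_sq
  obtain ⟨e1, e2, e3⟩ := stub_loopSymmetricLimit_normalForms
  rw [e1 R δ hδ, e2 E d₀ n]
  haveI := isProbabilityMeasure_fkDomainMeasure R.carrier δ hp hq0 (R.arc 0 ∪ R.arc 2)
  haveI := isProbabilityMeasure_rcMeasure (DiscreteRect.graph E) hp hq0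
    ({x | x.1 ∈ DiscreteRect.blackVerts E d₀ n 0} ∪ {x | x.1 ∈ DiscreteRect.blackVerts E d₀ n 2})
  exact e3.monotoneOn ⟨measureReal_nonneg, measureReal_le_one⟩
    ⟨measureReal_nonneg, measureReal_le_one⟩
    (stub_loopSymmetricLimit_lowerComparison R δ _ _ hδ hp selfDualParam_lt_one one_le_sqrt_two_sq
      E d₀ n C₀ C₂ h1 h2 h3 h4 h5 h6 h7 h8)

/-- **The lower assembly, with the harmonic-measure input as a hypothesis.** Assuming the
statement of `stub_loopSymmetricLimit_harmonicMeasureAlongSequence` (uniform radii and a uniform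
harmonic-measure lower bound along a Radó-convergent sequence of conformal rectangles), the
Chelkak–Smirnov crossing theorem and the DESIGN⁻ hypothesis imply
`∀ᶠ δ in 𝓝[>] 0, p η - κ < LS_δ` (see the module docstring for the proof).
[cite: ChelkakSmirnov2012Ising, Thm. 6.1] -/
theorem eventually_gt_of_harmonicMeasureAlongSequence
    (hHM : ∀ (R : ConformalRectangle) (Q : ℕ → ConformalRectangle),
      TendstoUniformly (fun n ↦ (Q n).boundary) R.boundary atTop →
      (∀ i : Fin 4, Tendsto (fun n ↦ (Q n).pt i) atTop (𝓝 (R.pt i))) →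
      ∀ z₀ ∈ R.carrier, ∃ r Rad t : ℝ, 0 < r ∧ 0 < Rad ∧ 0 < t ∧ ∀ᶠ n in atTop,
        Metric.ball z₀ r ⊆ (Q n).carrier ∧ (Q n).carrier ⊆ Metric.ball z₀ Rad ∧
          ∀ i : Fin 4, t ≤ harmonicMeasure (Q n).carrier z₀ ((Q n).arc i))
    (hCS : ChelkakSmirnov2012_fkIsingQuadrilateralCrossing)
    (hD : ∀ (R : ConformalRectangle) (τ : ℝ), 0 < τ → ∃ (Rm : ConformalRectangle) (C : ℝ),
      (∀ (φ : ConformalEquiv UpperHalfPlane.upperHalfPlaneSet R.carrier) (x : Fin 4 → ℝ),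
        R.IsUniformizing φ x →
        ∀ (φ' : ConformalEquiv UpperHalfPlane.upperHalfPlaneSet Rm.carrier) (x' : Fin 4 → ℝ),
          Rm.IsUniformizing φ' x' → |crossRatio x' - crossRatio x| < τ) ∧
      ∀ᶠ δ in 𝓝[>] (0 : ℝ), ∃ (E : Finset (Sym2 (Site 2))) (d₀ : Site 2 × Fin 4)
        (n : Fin 4 → ℕ) (Q : ConformalRectangle) (C₀ C₂ : Set (Sym2 (Site 2))),
        DiscreteRect.IsCSQuadrilateral E d₀ n ∧ DiscreteRect.csDomain E d₀ n δ = Q.carrier ∧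
        (∀ j : Fin 4, Q.pt j = meshPoint δ (DiscreteRect.csCorner E d₀ n j)) ∧
        Q.arc 0 ⊆ DiscreteRect.blackArc E d₀ n δ 0 ∧ Q.arc 2 ⊆ DiscreteRect.blackArc E d₀ n δ 2 ∧
        (∀ t : ℝ, dist (Q.boundary t) (Rm.boundary t) ≤ C * δ) ∧
        (∀ j : Fin 4, dist (Q.pt j) (Rm.pt j) ≤ C * δ) ∧
        Disjoint (DiscreteRect.blackVerts E d₀ n 0) (DiscreteRect.blackVerts E d₀ n 2) ∧
        (∀ v ∈ DiscreteRect.blackVerts E d₀ n 0 ∪ DiscreteRect.blackVerts E d₀ n 2,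
          v ∉ meshDomain R.carrier δ) ∧
        (∀ e ∈ E, e ∉ (discreteDomainGraph R.carrier δ).edgeSet → e ∈ C₀ ∪ C₂) ∧
        (∀ x : Site 2, (∃ e ∈ C₀, x ∈ e) → (∃ y, (discreteDomainGraph R.carrier δ).Adj x y) →
          x ∈ discreteArc R.carrier δ (R.arc 0)) ∧
        (∀ x : Site 2, (∃ e ∈ C₂, x ∈ e) → (∃ y, (discreteDomainGraph R.carrier δ).Adj x y) →
          x ∈ discreteArc R.carrier δ (R.arc 2)) ∧
        (∀ x : Site 2, (∃ e ∈ C₀, x ∈ e) → ¬ ∃ e ∈ C₂, x ∈ e) ∧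
        (∀ x ∈ DiscreteRect.blackVerts E d₀ n 0, ∀ e ∈ E, x ∈ e → e ∈ C₀) ∧
        (∀ y ∈ DiscreteRect.blackVerts E d₀ n 2, ∀ e ∈ E, y ∈ e → e ∈ C₂))
    (R : ConformalRectangle) (φ : ConformalEquiv UpperHalfPlane.upperHalfPlaneSet R.carrier)
    (x : Fin 4 → ℝ) (hφ : R.IsUniformizing φ x) (κ : ℝ) (hκ : 0 < κ) :
    ∀ᶠ δ in 𝓝[>] (0 : ℝ),
      fkIsingCrossingFunction (crossRatio x) - κ <
        aeval (Real.sqrt 2) (fkTwoArcCrossingPolynomial R δ ArcWiring.joint) /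
          (aeval (Real.sqrt 2) (fkTwoArcCrossingPolynomial R δ ArcWiring.joint) +
            Real.sqrt 2 * (aeval (Real.sqrt 2) (fkTwoArcPartitionPolynomials R δ ArcWiring.joint) -
              aeval (Real.sqrt 2) (fkTwoArcCrossingPolynomial R δ ArcWiring.joint))) := by
  -- continuity of `p` at `η`, the approximant `Rm` and one of its uniformizing data
  obtain ⟨τ, hτ, hτp⟩ := Metric.continuousAt_iff.1
    (FkIsingCrossingFunctionProps.fkIsingCrossingFunction_continuous.continuousAt :
      ContinuousAt fkIsingCrossingFunction (crossRatio x)) κ hκ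
  obtain ⟨Rm, C, hcr, hev⟩ := hD R τ hτ
  obtain ⟨φm, xm, hφm⟩ := MarkedDomain.exists_isUniformizing_holds Rm
  have hgt : fkIsingCrossingFunction (crossRatio x) - κ <
      fkIsingCrossingFunction (crossRatio xm) := by
    have h : dist (fkIsingCrossingFunction (crossRatio xm))
        (fkIsingCrossingFunction (crossRatio x)) < κ :=
      hτp (show dist (crossRatio xm) (crossRatio x) < τ by
        rw [Real.dist_eq]; exact hcr φ x hφ φm xm hφm)
    rw [Real.dist_eq] at h
    linarith [(abs_lt.1 h).1]
  -- argue by contradiction along a sequence `δ_k → 0⁺` in the good set where the claim fails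
  by_contra hne
  obtain ⟨δs, hδs, hall⟩ := exists_seq_forall_of_frequently
    ((not_eventually.1 hne).and_eventually (eventually_mem_nhdsWithin.and hev))
  choose hnot hmem E d₀ nn Q C₀ C₂ hq hcar hpt harc0 harc2 hbd hptd h1 h2 h3 h4 h5 h6 h7 h8
    using hall
  have hpos : ∀ k, 0 < δs k := fun k ↦ Set.mem_Ioi.1 (hmem k)
  have hδ0 : Tendsto δs atTop (𝓝 0) := hδs.mono_right nhdsWithin_le_nhds
  -- Radó convergence `Q_k → Rm`
  have hJ : TendstoUniformly (fun k ↦ (Q k).boundary) Rm.boundary atTop :=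
    tendstoUniformly_of_dist_le hδ0 hbd
  have hptc : ∀ i : Fin 4, Tendsto (fun k ↦ (Q k).pt i) atTop (𝓝 (Rm.pt i)) := fun i ↦
    tendsto_of_dist_le hδ0 fun k ↦ hptd k i
  -- uniform radii and harmonic-measure bound, then the Chelkak–Smirnov limit along the sequence
  obtain ⟨z₀, hz₀⟩ := Rm.nonempty
  obtain ⟨r, Rad, t, hr, hRad, ht, hgeom⟩ := hHM Rm Q hJ hptc z₀ hz₀
  have hlim := stub_loopSymmetricLimit_csLimitAlongSequence hCS Rm Q δs E d₀ nn hpos hδ0 hq hcar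
    hpt (fun k ↦ ⟨harc0 k, harc2 k⟩) hJ hptc ⟨z₀, r, Rad, t, hr, hRad, ht, hgeom⟩ φm xm hφm
  obtain ⟨k, hk⟩ := (hlim.eventually_const_lt hgt).exists
  exact hnot k (hk.trans_le (csCrossingProb_le_loopSymmetric R (hpos k) (E k) (d₀ k) (nn k)
    (C₀ k) (C₂ k) (h1 k) (h2 k) (h3 k) (h4 k) (h5 k) (h6 k) (h7 k) (h8 k)))

end AssemblyLower

open AssemblyLower in
/-- **Registered stub `stub_loopSymmetricLimit_assemblyLower`** of the `n = 0` bridge of the crux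
`IsingJetsConformal` (stmt-CriticalPhenomena-5560), the LOWER half: assuming the Chelkak–Smirnov
crossing theorem `ChelkakSmirnov2012_fkIsingQuadrilateralCrossing` and the DESIGN⁻ hypothesis
(approximants `Rm` of `R` with `τ`-close modulus carrying, eventually in the mesh `δ → 0⁺`, glued
Chelkak–Smirnov discrete quadrilaterals `C δ`-close to `Rm` with the collars of
`stub_loopSymmetricLimit_lowerComparison`), for every conformal rectangle `R` with uniformizing
datum `(φ, x)` and every `κ > 0`, eventually as `δ → 0⁺` the loop-symmetric critical FK-Ising
crossing ratio `N_δ(√2) / (N_δ(√2) + √2 (Z^joint_δ(√2) - N_δ(√2)))` of `Ω_δ` is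
`> fkIsingCrossingFunction (crossRatio x) - κ`. Proof:
`AssemblyLower.eventually_gt_of_harmonicMeasureAlongSequence` with the landed input
`stub_loopSymmetricLimit_harmonicMeasureAlongSequence`.
[cite: ChelkakSmirnov2012Ising, Thm. 6.1] -/
theorem stub_loopSymmetricLimit_assemblyLower :
    (Literature.Probability.LatticeModels.ChelkakSmirnov2012_fkIsingQuadrilateralCrossing → (∀ (R : Literature.Probability.RandomPlanarGeometry.ConformalRectangle) (τ : ℝ), 0 < τ → ∃ (Rm : Literature.Probability.RandomPlanarGeometry.ConformalRectangle) (C : ℝ), (∀ (φ : Literature.Probability.RandomPlanarGeometry.ConformalEquiv UpperHalfPlane.upperHalfPlaneSet R.carrier) (x : Fin 4 → ℝ), R.IsUniformizing φ x → ∀ (φ' : Literature.Probability.RandomPlanarGeometry.ConformalEquiv UpperHalfPlane.upperHalfPlaneSet Rm.carrier) (x' : Fin 4 → ℝ), Rm.IsUniformizing φ' x' → |Literature.Probability.RandomPlanarGeometry.crossRatio x' - Literature.Probability.RandomPlanarGeometry.crossRatio x| < τ) ∧ ∀ᶠ δ in nhdsWithin (0 : ℝ) (Set.Ioi 0), ∃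 (E : Finset (Sym2 (Literature.Probability.LatticeModels.Site 2))) (d₀ : Literature.Probability.LatticeModels.Site 2 × Fin 4) (n : Fin 4 → ℕ) (Q : Literature.Probability.RandomPlanarGeometry.ConformalRectangle) (C₀ C₂ : Set (Sym2 (Literature.Probability.LatticeModels.Site 2))), Literature.Probability.LatticeModels.DiscreteRect.IsCSQuadrilateral E d₀ n ∧ Literature.Probability.LatticeModels.DiscreteRect.csDomain E d₀ n δ = Q.carrier ∧ (∀ j : Fin 4, Q.pt j = Literature.Probability.LatticeModels.meshPoint δ (Literature.Probability.LatticeModels.DiscreteRect.csCorner E d₀ n j)) ∧ Q.arc 0 ⊆ Literature.Probability.LatticeModels.DiscreteRect.blackArc E d₀ n δ 0 ∧ Q.arc 2 ⊆ Literature.Probability.LatticeModels.DiscreteRect.blackArc E d₀ n δ 2 ∧ (∀ t : ℝ, dist (Q.boundary t) (Rm.boundary t) ≤ C * δ) ∧ (∀ j : Fin 4, dist (Q.pt j) (Rm.pt j) ≤ C * δ) ∧ Disjoint (Literature.Probability.LatticeModels.DiscreteRect.blackVerts E d₀ n 0) (Literature.Probability.LatticeModels.DiscreteRect.blackVerts E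 d₀ n 2) ∧ (∀ v ∈ Literature.Probability.LatticeModels.DiscreteRect.blackVerts E d₀ n 0 ∪ Literature.Probability.LatticeModels.DiscreteRect.blackVerts E d₀ n 2, v ∉ Literature.Probability.LatticeModels.meshDomain R.carrier δ) ∧ (∀ e ∈ E, e ∉ (Literature.Probability.LatticeModels.discreteDomainGraph R.carrier δ).edgeSet → e ∈ C₀ ∪ C₂) ∧ (∀ x : Literature.Probability.LatticeModels.Site 2, (∃ e ∈ C₀, x ∈ e) → (∃ y, (Literature.Probability.LatticeModels.discreteDomainGraph R.carrier δ).Adj x y) → x ∈ Literature.Probability.LatticeModels.discreteArc R.carrier δ (R.arc 0)) ∧ (∀ x : Literature.Probability.LatticeModels.Site 2, (∃ e ∈ C₂, x ∈ e) → (∃ y, (Literature.Probability.LatticeModels.discreteDomainGraph R.carrier δ).Adj x y) → x ∈ Literature.Probability.LatticeModels.discreteArc R.carrier δ (R.arc 2)) ∧ (∀ x : Literature.Probability.LatticeModels.Site 2, (∃ e ∈ C₀, x ∈ e) → ¬ ∃ e ∈ C₂, x ∈ e) ∧ (∀ x ∈ Literature.Probability.LatticeModels.DiscreteRect.blackVerts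 E d₀ n 0, ∀ e ∈ E, x ∈ e → e ∈ C₀) ∧ (∀ y ∈ Literature.Probability.LatticeModels.DiscreteRect.blackVerts E d₀ n 2, ∀ e ∈ E, y ∈ e → e ∈ C₂)) → ∀ (R : Literature.Probability.RandomPlanarGeometry.ConformalRectangle) (φ : Literature.Probability.RandomPlanarGeometry.ConformalEquiv UpperHalfPlane.upperHalfPlaneSet R.carrier) (x : Fin 4 → ℝ), R.IsUniformizing φ x → ∀ κ : ℝ, 0 < κ → ∀ᶠ δ in nhdsWithin (0 : ℝ) (Set.Ioi 0), Literature.Probability.LatticeModels.fkIsingCrossingFunction (Literature.Probability.RandomPlanarGeometry.crossRatio x) - κ < Polynomial.aeval (Real.sqrt 2) (Literature.Probability.LatticeModels.fkTwoArcCrossingPolynomial R δ Literature.Probability.LatticeModels.ArcWiring.joint) / (Polynomial.aeval (Real.sqrt 2) (Literature.Probability.LatticeModels.fkTwoArcCrossingPolynomial R δ Literature.Probability.LatticeModels.ArcWiring.joint) + Real.sqrt 2 * (Polynomial.aeval (Real.sqrt 2) (Literature.Probability.LatticeModels.fkTwoArcPartitionPolynomials R δ Literature.Probability.LatticeModels.ArcWiring.joint)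 - Polynomial.aeval (Real.sqrt 2) (Literature.Probability.LatticeModels.fkTwoArcCrossingPolynomial R δ Literature.Probability.LatticeModels.ArcWiring.joint)))) := by
  intro hCS hD R φ x hφ κ hκ
  exact eventually_gt_of_harmonicMeasureAlongSequence
    stub_loopSymmetricLimit_harmonicMeasureAlongSequence hCS hD R φ x hφ κ hκ

end

end Summit.CriticalPhenomena.CardyFormulaZ2.Theorems.CardyQContinuation
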